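import Summits.HodgeConjecture.HodgeConjecture.Theorems.Ring2WeilCoverageCMFieldAllPrimesB
import Summits.HodgeConjecture.HodgeConjecture.Theorems.Ring2WeilCoverageCMFieldTablesA
import HarnessLib

/-!
# Weil-type components over quartic CM fields, IX (part E): THUE'S LEMMA and the SPLIT side for all primes —
# complete prime classifications for the biquadratic census fields `ℚ(ζ₈)`, `ℚ(ζ₁₂)`, `ℚ(i,√5)`, `ℚ(√-3,√5)`

research route conditional on HC_CM; not a corollary; Q11.4-sentence-2 already refuted in dim ≥ 3. Cell
`pub-hodge-ring2`, seat `ring2-b03` (gen 51); continuation of parts A/B. Parts A–B decide the NON-split side of the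
four `V₄` census tables for every prime (`[ℓ] ≠ [1]` on a congruence class) and the split side for `ℓ ≢ 3 (mod 4)`
(two squares). This part closes the split side for ALL remaining primes by THUE'S LEMMA (§1, pigeonhole in `𝔽_ℓ`:
`x ≡ ty`, `0 < x², y² < ℓ`): a square root `t` of `-d` mod `ℓ` gives `x² + dy² = kℓ` with `1 ≤ k ≤ d` (§1), and since
`x + y√-d ∈ E` this says `[kℓ] = [1]`; the finitely many `k ≤ d` are split classes by the numerals of gen 49 (or
excluded by a residue computation), so `[ℓ] = [k]⁻¹ = [1]` (every class has order two, part VIII). Per field (§3–§6):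

* `ℚ(ζ₈)` (`d = 2`, `√-2 = η(7+σ)/2`): `[ℓ] = [1]` for `ℓ ≡ 1, 3 (mod 8)`; with part A: **for every prime `ℓ`,
  `[ℓ] ≠ [1] ⟺ ℓ ≡ 7 (mod 8)`**;
* `ℚ(ζ₁₂)` (`d = 3`, `√-3 = η(10+σ)/4`): `[ℓ] = [1]` for `ℓ ≡ 1 (mod 3)`; **`[ℓ] ≠ [1] ⟺ ℓ ≡ 11 (mod 12)`**;
* `ℚ(i,√5)` (`d = 5`, `√-5 = (4+σ)η`): `[ℓ] = [1]` for `ℓ ≡ 1, 3, 7, 9 (mod 20)`; **`[ℓ] ≠ [1] ⟺ ℓ ≡ 11, 19 (mod 20)`**;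
* `ℚ(√-3,√5)` (`d = 3`, `√-3 = -η(6+σ)/3`, and `d = 15`, `√-15 = η(12+σ)/3`, `k = 11` excluded mod `11`):
  `[ℓ] = [1]` for `ℓ ≡ 1 (mod 3)` and for `ℓ ≡ 2 (mod 3)`, `ℓ ≡ ±2 (mod 5)`; **`[ℓ] ≠ [1] ⟺ ℓ ≡ 11, 14 (mod 15)`**.

So for the four biquadratic census fields the column «is `W8.E.[ℓ]` the split component?» of the census is decided
for EVERY rational prime `ℓ` by one congruence, in the kernel (gens 46–49: `n ≤ 40` by numerals). No named fact,
no definition, no `sorry`; nothing about the Hodge conjecture is asserted (Deligne Cor. 4.2 / Landherr: the split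
component is the one with an `E`-Lagrangian member; the general member of every row is OPEN, census §b03.2).
References: [Deligne1982HodgeCycles] §4 p. 30 (1), Cor. 4.2, Lemma 4.6; [Landherr1936HermitianForms]. -/

noncomputable section

set_option linter.dupNamespace false

open Polynomial

namespace Summit.HodgeConjecture.HodgeConjecture.Ring2.WeilCoverageCM

open Literature.AlgebraicGeometry.Deligne1982
open Literature.AlgebraicGeometry.HodgeTheory (splitDiscriminantClassCM)

/-! ### §1 Thue's lemma and `x² + dy² = kℓ`, `k ≤ d` -/

section Thue

variable {ℓ : ℕ} [hℓ : Fact ℓ.Prime]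

/-- **Thue's lemma.** For a prime `ℓ` and `t ∈ 𝔽_ℓ` there are integers `x, y`, not both zero, with `x² < ℓ`, `y² < ℓ`
and `x ≡ t·y (mod ℓ)` (pigeonhole on the `(⌊√ℓ⌋ + 1)² > ℓ` values `u - tv`, `0 ≤ u, v ≤ ⌊√ℓ⌋`). [folklore] -/
theorem thue_lemma (t : ZMod ℓ) :
    ∃ x y : ℤ, (x ≠ 0 ∨ y ≠ 0) ∧ x ^ 2 < ℓ ∧ y ^ 2 < ℓ ∧ (x : ZMod ℓ) = t * y := by
  classical
  obtain ⟨m, hm⟩ : ∃ m, m = Nat.sqrt ℓ := ⟨_, rfl⟩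
  have hle : m ^ 2 ≤ ℓ := by rw [hm]; exact Nat.sqrt_le' ℓ
  have hsucc : ℓ < (m + 1) ^ 2 := by rw [hm]; exact Nat.lt_succ_sqrt' ℓ
  have hm2 : m ^ 2 < ℓ := by
    rcases hle.lt_or_eq with h | h
    · exact h
    · exfalso
      have hdvd : m ∣ ℓ := ⟨m, by rw [← h]; ring⟩
      have h1 := hℓ.out.one_lt
      rcases (Nat.dvd_prime hℓ.out).1 hdvd with h2 | h2
      · rw [h2] at h; omega
      · rw [h2] at h; nlinarith
  let S : Finset (ℕ × ℕ) := Finset.range (m + 1) ×ˢ Finset.range (m + 1)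
  have hS : S.card = (m + 1) ^ 2 := by simp [S, Finset.card_product, sq]
  have hlt : (Finset.univ : Finset (ZMod ℓ)).card < S.card := by
    rw [Finset.card_univ, ZMod.card, hS]; exact hsucc
  obtain ⟨a, ha, b, hb, hne, heq⟩ := Finset.exists_ne_map_eq_of_card_lt_of_maps_to hlt
    (f := fun uv : ℕ × ℕ => ((uv.1 : ZMod ℓ) - t * uv.2)) (fun _ _ => Finset.mem_coe.2 (Finset.mem_univ _))
  simp only [S, Finset.mem_product, Finset.mem_range] at ha hb
  refine ⟨(a.1 : ℤ) - b.1, (a.2 : ℤ) - b.2, ?_, ?_, ?_, ?_⟩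
  · by_contra h
    obtain ⟨h1, h2⟩ := not_or.1 h
    rw [not_not] at h1 h2
    exact hne (Prod.ext (by omega) (by omega))
  · have h1 : ((a.1 : ℤ) - b.1) ^ 2 ≤ (m : ℤ) ^ 2 := sq_le_sq' (by omega) (by omega)
    have h2 : ((m : ℤ)) ^ 2 < ℓ := by exact_mod_cast hm2
    omega
  · have h1 : ((a.2 : ℤ) - b.2) ^ 2 ≤ (m : ℤ) ^ 2 := sq_le_sq' (by omega) (by omega)
    have h2 : ((m : ℤ)) ^ 2 < ℓ := by exact_mod_cast hm2
    omega
  · push_cast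
    linear_combination heq

/-- **`x² + dy² = kℓ` with `1 ≤ k ≤ d` and `y ≠ 0`, from a square root `t` of `-d` mod `ℓ`** (Thue: `x ≡ ty`, so
`ℓ ∣ x² + dy²`, and `0 < x² + dy² < (1 + d)ℓ`). [folklore] -/
theorem exists_sq_add_mul_sq_eq_mul_prime (d : ℕ) (hd : 0 < d) (t : ZMod ℓ) (ht : t ^ 2 = -(d : ZMod ℓ)) :
    ∃ x y : ℤ, ∃ k : ℕ, y ≠ 0 ∧ 1 ≤ k ∧ k ≤ d ∧ x ^ 2 + d * y ^ 2 = (k : ℤ) * ℓ := by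
  have hℓp : Prime (ℓ : ℤ) := Nat.prime_iff_prime_int.1 hℓ.out
  have hℓ2 : (2 : ℤ) ≤ ℓ := by exact_mod_cast hℓ.out.two_le
  obtain ⟨x, y, hne, hx, hy, hxy⟩ := thue_lemma t
  have hdvd : (ℓ : ℤ) ∣ x ^ 2 + d * y ^ 2 := by
    rw [← ZMod.intCast_zmod_eq_zero_iff_dvd]
    push_cast
    rw [hxy]
    linear_combination (y : ZMod ℓ) ^ 2 * ht
  obtain ⟨k, hk⟩ := hdvd
  have hy0 : y ≠ 0 := by
    rintro rfl
    have hx0 : x ≠ 0 := by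
      rcases hne with h | h
      · exact h
      · exact absurd rfl h
    have hdx : (ℓ : ℤ) ∣ x := hℓp.dvd_of_dvd_pow (n := 2) ⟨k, by linear_combination hk⟩
    obtain ⟨c, rfl⟩ := hdx
    have hc : c ≠ 0 := by rintro rfl; exact hx0 (by ring)
    have hc1 : 1 ≤ c ^ 2 := by
      rcases Int.ne_iff_lt_or_gt.1 hc with h | h <;> nlinarith
    have h1 : ((ℓ : ℤ) * c) ^ 2 = (ℓ : ℤ) ^ 2 * c ^ 2 := by ring
    have h2 : (ℓ : ℤ) ^ 2 * 1 ≤ (ℓ : ℤ) ^ 2 * c ^ 2 := mul_le_mul_of_nonneg_left hc1 (sq_nonneg _)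
    nlinarith
  have hy1 : 1 ≤ y ^ 2 := by
    rcases Int.ne_iff_lt_or_gt.1 hy0 with h | h <;> nlinarith
  have hk1 : 1 ≤ k := by
    by_contra hk0
    rw [not_le] at hk0
    have : (ℓ : ℤ) * k ≤ 0 := by nlinarith
    nlinarith [sq_nonneg x]
  have hkd : k ≤ d := by
    by_contra hkd
    rw [not_le] at hkd
    have h1 : (ℓ : ℤ) * (d + 1) ≤ ℓ * k := by nlinarith
    nlinarith
  obtain ⟨n, rfl⟩ := Int.eq_ofNat_of_zero_le (by omega : (0 : ℤ) ≤ k)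
  exact ⟨x, y, n, hy0, by exact_mod_cast hk1, by exact_mod_cast hkd, by linear_combination hk⟩

end Thue

/-! ### §2 Residue constructions: `-3`, `-5`, `-15` as squares from congruences; the split transfer -/

section Residues

variable {ℓ : ℕ} [hℓ : Fact ℓ.Prime]

/-- **`-3` is a square mod a prime `ℓ ≡ 1 (mod 3)`**: an element `ω` of order `3` in `𝔽_ℓ^×` (Cauchy) has
`ω² + ω + 1 = 0`, so `(2ω + 1)² = -3`. [folklore] -/
theorem isSquare_neg_three_of_mod_three (h3 : ℓ % 3 = 1) : IsSquare (-3 : ZMod ℓ) := by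
  haveI : Fact (Nat.Prime 3) := ⟨Nat.prime_three⟩
  have hcard : 3 ∣ Fintype.card (ZMod ℓ)ˣ := by
    rw [ZMod.card_units ℓ]; have := hℓ.out.two_le; omega
  obtain ⟨ω, hω⟩ := exists_prime_orderOf_dvd_card 3 hcard
  have hω3 : ((ω : ZMod ℓ)) ^ 3 = 1 := by
    rw [← Units.val_pow_eq_pow_val, ← hω, pow_orderOf_eq_one, Units.val_one]
  have hω1 : (ω : ZMod ℓ) ≠ 1 := by
    intro h
    have : ω = 1 := Units.ext h
    rw [this, orderOf_one] at hω
    norm_num at hω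
  have hquad : (ω : ZMod ℓ) ^ 2 + ω + 1 = 0 := by
    have : ((ω : ZMod ℓ) - 1) * ((ω : ZMod ℓ) ^ 2 + ω + 1) = 0 := by linear_combination hω3
    exact (mul_eq_zero.mp this).resolve_left (sub_ne_zero.mpr hω1)
  exact ⟨2 * ω + 1, by linear_combination (-4 : ZMod ℓ) * hquad⟩

/-- **The product of two non-squares of `𝔽_ℓ^×` is a square** (Euler's criterion: `a^((ℓ-1)/2) = b^((ℓ-1)/2) = -1`).
[folklore] -/
theorem isSquare_mul_of_not_isSquare {a b : ZMod ℓ} (ha : ¬ IsSquare a) (hb : ¬ IsSquare b) : IsSquare (a * b) := by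
  have ha0 : a ≠ 0 := by rintro rfl; exact ha ⟨0, by ring⟩
  have hb0 : b ≠ 0 := by rintro rfl; exact hb ⟨0, by ring⟩
  have ha' : a ^ (ℓ / 2) = -1 := (ZMod.pow_div_two_eq_neg_one_or_one ℓ ha0).resolve_left
    (fun h => ha ((ZMod.euler_criterion ℓ ha0).2 h))
  have hb' : b ^ (ℓ / 2) = -1 := (ZMod.pow_div_two_eq_neg_one_or_one ℓ hb0).resolve_left
    (fun h => hb ((ZMod.euler_criterion ℓ hb0).2 h))
  rw [ZMod.euler_criterion ℓ (mul_ne_zero ha0 hb0), mul_pow, ha', hb']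
  ring

/-- **`-5` is a square mod a prime `ℓ ≡ 1, 3, 7, 9 (mod 20)`** (`(-5/ℓ) = (-1/ℓ)(5/ℓ)`: both `+1` for
`ℓ ≡ 1, 9 (mod 20)`, both `-1` for `ℓ ≡ 3, 7 (mod 20)`). [folklore] -/
theorem isSquare_neg_five_of_mod_twenty (h20 : ℓ % 20 = 1 ∨ ℓ % 20 = 3 ∨ ℓ % 20 = 7 ∨ ℓ % 20 = 9) :
    IsSquare (-5 : ZMod ℓ) := by
  have h2 : ℓ ≠ 2 := by omega
  rcases h20 with h | h | h | h
  · obtain ⟨i, hi⟩ := ZMod.exists_sq_eq_neg_one_iff.2 (by omega : ℓ % 4 ≠ 3)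
    obtain ⟨r, hr⟩ := isSquare_five_of_mod_five (ℓ := ℓ) h2 (Or.inl (by omega))
    exact ⟨i * r, by linear_combination (5 : ZMod ℓ) * hi + i * i * hr⟩
  · rw [show (-5 : ZMod ℓ) = -1 * 5 by ring]
    exact isSquare_mul_of_not_isSquare (by rw [ZMod.exists_sq_eq_neg_one_iff]; omega)
      (not_isSquare_five_of_mod_five h2 (Or.inr (by omega)))
  · rw [show (-5 : ZMod ℓ) = -1 * 5 by ring]
    exact isSquare_mul_of_not_isSquare (by rw [ZMod.exists_sq_eq_neg_one_iff]; omega)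
      (not_isSquare_five_of_mod_five h2 (Or.inl (by omega)))
  · obtain ⟨i, hi⟩ := ZMod.exists_sq_eq_neg_one_iff.2 (by omega : ℓ % 4 ≠ 3)
    obtain ⟨r, hr⟩ := isSquare_five_of_mod_five (ℓ := ℓ) h2 (Or.inr (by omega))
    exact ⟨i * r, by linear_combination (5 : ZMod ℓ) * hi + i * i * hr⟩

/-- **`-15` is a square mod a prime `ℓ ≡ 2 (mod 3)`, `ℓ ≡ ±2 (mod 5)`, `ℓ ≠ 2`** (`-3` and `5` both non-squares).
[folklore] -/
theorem isSquare_neg_fifteen_of_mod (h2 : ℓ ≠ 2) (h3 : ℓ % 3 = 2) (h5 : ℓ % 5 = 2 ∨ ℓ % 5 = 3) :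
    IsSquare (-15 : ZMod ℓ) := by
  have hℓ3 : ℓ ≠ 3 := by omega
  rw [show (-15 : ZMod ℓ) = -3 * 5 by ring]
  refine isSquare_mul_of_not_isSquare ?_ (not_isSquare_five_of_mod_five h2 h5)
  rintro ⟨y, hy⟩
  have := three_dvd_sub_one_of_sq_eq_neg_three h2 hℓ3 y (by rw [sq, ← hy])
  omega

end Residues

section Transfer

variable {R : Polynomial ℤ} [Fact (Irreducible (realPolyQ R))] [Fact (Irreducible (cmPolyQ R))]

/-- **Split transfer**: `[kℓ] = [1]` and `[k] = [1]` give `[ℓ] = [1]` (classes have order two).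
[cite: Deligne1982HodgeCycles, §4 p. 30 (1) and Cor. 4.2] -/
theorem mk_eq_split_of_mul_of_factor (u v : (realField R)ˣ)
    (huv : (QuotientGroup.mk (u * v) : cmNormResidueGroup R) = splitDiscriminantClassCM R 2)
    (hv : (QuotientGroup.mk v : cmNormResidueGroup R) = splitDiscriminantClassCM R 2) :
    (QuotientGroup.mk u : cmNormResidueGroup R) = splitDiscriminantClassCM R 2 := by
  rw [mk_eq_mk_of_mk_mul_eq_split u v huv, hv]

/-- **From a Thue representation to the split class.** An integer norm witness for `kℓ` (coordinates
`(A, B, C, D, m)` of `(A + Bσ)² - σ(C + Dσ)² = kℓ·m²`, i.e. `[kℓ] = [1]`) together with `[k] = [1]` gives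
`[ℓ] = [1]`; the fields supply the identities (`x + y√-d ∈ E` written in Deligne's basis) and the numerals `[k] = [1]`,
`k ≤ d` (gen 49 tables). [cite: Deligne1982HodgeCycles, §4 p. 30 (1) and Cor. 4.2] -/
theorem mk_natCast_eq_split_of_mul {p q : ℤ} (hR : R = X ^ 2 + C p * X + C q) (ℓ k : ℕ) (hk : 1 ≤ k)
    (A B Cc D m : ℤ) (hm : m ≠ 0)
    (hX : A ^ 2 - q * B ^ 2 + 2 * q * Cc * D - p * q * D ^ 2 = ((k : ℤ) * ℓ) * m ^ 2)
    (hY : 2 * A * B - p * B ^ 2 - Cc ^ 2 + 2 * p * Cc * D - (p ^ 2 - q) * D ^ 2 = 0)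
    (hsplitk : ∀ v : (realField R)ˣ, (v : realField R) = k →
      (QuotientGroup.mk v : cmNormResidueGroup R) = splitDiscriminantClassCM R 2)
    (u : (realField R)ˣ) (hu : (u : realField R) = ℓ) :
    (QuotientGroup.mk u : cmNormResidueGroup R) = splitDiscriminantClassCM R 2 := by
  set v : (realField R)ˣ := Units.mk0 (k : realField R) (natCast_ne_zero_realField k hk) with hv
  refine mk_eq_split_of_mul_of_factor u v ?_ (hsplitk v (Units.val_mk0 _))
  refine mk_eq_splitDiscriminantClassCM_two_of_coords hR ((k : ℤ) * ℓ) A B Cc D m hm hX hY (u * v) ?_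
  rw [Units.val_mul, hu, hv, Units.val_mk0, Int.cast_mul, Int.cast_natCast, Int.cast_natCast, map_mul, map_natCast,
    map_natCast, mul_comm]

end Transfer

/-! ### §3 `E = ℚ(ζ₈)`: `[ℓ] = [1]` for `ℓ ≡ 1, 3 (mod 8)`; the complete classification `[ℓ] ≠ [1] ⟺ ℓ ≡ 7 (mod 8)` -/

section Zeta8

variable {R : Polynomial ℤ} (hR : R = X ^ 2 + C 6 * X + C 1) [Fact (Irreducible (realPolyQ R))]
include hR

/-- **`[ℓ] = [1]` for `E = ℚ(ζ₈)` and EVERY prime `ℓ ≡ 1, 3 (mod 8)`** (`-2 = t²` mod `ℓ`; Thue: `x² + 2y² = kℓ`, `k ≤ 2`;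
`x + y√-2 ∈ E`, `√-2 = η(7+σ)/2`, witness coordinates `(2x)² - σ(7y + yσ)² ↦ (4kℓ, 0)`; `[2] = [1]`, gen 49): the
rows `W8.E.[ℓ]`, `ℓ ≡ 3 (mod 8)` (`3, 11, 19, 43, …`) are the SPLIT component — the case two squares do not reach.
[cite: Deligne1982HodgeCycles, §4 p. 30 (1) and Cor. 4.2] -/
theorem zeta8_mk_prime_eq_splitDiscriminantClassCM_of_mod_eight (ℓ : ℕ) (hℓ : ℓ.Prime)
    (h8 : ℓ % 8 = 1 ∨ ℓ % 8 = 3) (u : (realField R)ˣ) (hu : (u : realField R) = ℓ) :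
    (QuotientGroup.mk u : cmNormResidueGroup R) = splitDiscriminantClassCM R 2 := by
  haveI : Fact ℓ.Prime := ⟨hℓ⟩
  haveI := fact_irreducible_cmPolyQ_of_pos hR (by norm_num) (by norm_num) disc_not_sq_six_one
  obtain ⟨t, ht⟩ := (ZMod.exists_sq_eq_neg_two_iff (by omega)).2 h8
  obtain ⟨x, y, k, -, hk1, hk2, hxy⟩ :=
    exists_sq_add_mul_sq_eq_mul_prime (ℓ := ℓ) 2 (by norm_num) t (by rw [sq, ← ht]; push_cast; ring)
  refine mk_natCast_eq_split_of_mul hR ℓ k hk1 (2 * x) 0 (7 * y) y 2 two_ne_zero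
    (by push_cast at hxy ⊢; linear_combination 4 * hxy) (by ring) ?_ u hu
  intro v hv
  exact (zeta8_table hR k hk1 (by omega) v hv).2 (by simp only [Finset.mem_insert, Finset.mem_singleton]; omega)

/-- **COMPLETE PRIME CLASSIFICATION for `E = ℚ(ζ₈) = ℚ(i,√2)`: for every prime `ℓ`, `[ℓ] ≠ [1] ⟺ ℓ ≡ 7 (mod 8)`**
— the Weil-type component `W8.E.[ℓ]` of abelian eightfolds with `E`-signature `(2,2;2,2)` is NON-SPLIT exactly for
the primes `7, 23, 31, 47, 71, 79, …` (part A: `⇐`; two squares for `ℓ ≢ 3 (mod 4)`, Thue for `ℓ ≡ 3 (mod 8)`).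
[cite: Deligne1982HodgeCycles, §4 p. 30 (1) and Cor. 4.2] [cite: Landherr1936HermitianForms] -/
theorem zeta8_mk_prime_ne_splitDiscriminantClassCM_iff (ℓ : ℕ) (hℓ : ℓ.Prime) (u : (realField R)ˣ)
    (hu : (u : realField R) = ℓ) :
    (QuotientGroup.mk u : cmNormResidueGroup R) ≠ splitDiscriminantClassCM R 2 ↔ ℓ % 8 = 7 := by
  refine ⟨fun hne => ?_, fun h8 => zeta8_mk_prime_ne_splitDiscriminantClassCM_of_mod_eight hR ℓ hℓ h8 u hu⟩
  by_contra h8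
  have h2 := hℓ.two_le
  by_cases hℓ2 : ℓ = 2
  · subst hℓ2
    exact hne (zeta8_mk_prime_eq_splitDiscriminantClassCM_of_mod_four hR 2 hℓ (by norm_num) u hu)
  · have hodd : ¬ 2 ∣ ℓ := fun h => by
      rcases (Nat.dvd_prime hℓ).1 h with h | h <;> omega
    have : ℓ % 8 = 1 ∨ ℓ % 8 = 3 ∨ ℓ % 8 = 5 := by omega
    rcases this with h | h | h
    · exact hne (zeta8_mk_prime_eq_splitDiscriminantClassCM_of_mod_eight hR ℓ hℓ (Or.inl h) u hu)
    · exact hne (zeta8_mk_prime_eq_splitDiscriminantClassCM_of_mod_eight hR ℓ hℓ (Or.inr h) u hu)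
    · exact hne (zeta8_mk_prime_eq_splitDiscriminantClassCM_of_mod_four hR ℓ hℓ (by omega) u hu)

end Zeta8

/-! ### §4 `E = ℚ(ζ₁₂)`: `[ℓ] = [1]` for `ℓ ≡ 1 (mod 3)`; the complete classification `[ℓ] ≠ [1] ⟺ ℓ ≡ 11 (mod 12)` -/

section Zeta12

variable {R : Polynomial ℤ} (hR : R = X ^ 2 + C 8 * X + C 4) [Fact (Irreducible (realPolyQ R))]
include hR

/-- **`[ℓ] = [1]` for `E = ℚ(ζ₁₂)` and EVERY prime `ℓ ≡ 1 (mod 3)`** (`-3 = t²` mod `ℓ`; Thue: `x² + 3y² = kℓ`, `k ≤ 3`;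
`x + y√-3 ∈ E`, `√-3 = η(10+σ)/4`, witness `(4x)² - σ(10y + yσ)² ↦ (16kℓ, 0)`; `[2] = [3] = [1]`, gen 49): in
particular the rows `W8.E.[ℓ]`, `ℓ ≡ 7 (mod 12)` (`7, 19, 31, 43, …`) are the SPLIT component.
[cite: Deligne1982HodgeCycles, §4 p. 30 (1) and Cor. 4.2] -/
theorem zeta12_mk_prime_eq_splitDiscriminantClassCM_of_mod_three (ℓ : ℕ) (hℓ : ℓ.Prime) (h3 : ℓ % 3 = 1)
    (u : (realField R)ˣ) (hu : (u : realField R) = ℓ) :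
    (QuotientGroup.mk u : cmNormResidueGroup R) = splitDiscriminantClassCM R 2 := by
  haveI : Fact ℓ.Prime := ⟨hℓ⟩
  haveI := fact_irreducible_cmPolyQ_of_pos hR (by norm_num) (by norm_num) disc_not_sq_eight_four
  obtain ⟨t, ht⟩ := isSquare_neg_three_of_mod_three (ℓ := ℓ) h3
  obtain ⟨x, y, k, -, hk1, hk2, hxy⟩ :=
    exists_sq_add_mul_sq_eq_mul_prime (ℓ := ℓ) 3 (by norm_num) t (by rw [sq, ← ht]; push_cast; ring)
  refine mk_natCast_eq_split_of_mul hR ℓ k hk1 (4 * x) 0 (10 * y) y 4 (by norm_num)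
    (by push_cast at hxy ⊢; linear_combination 16 * hxy) (by ring) ?_ u hu
  intro v hv
  exact (zeta12_table hR k hk1 (by omega) v hv).2 (by simp only [Finset.mem_insert, Finset.mem_singleton]; omega)

/-- **COMPLETE PRIME CLASSIFICATION for `E = ℚ(ζ₁₂) = ℚ(i,√3)`: for every prime `ℓ`, `[ℓ] ≠ [1] ⟺ ℓ ≡ 11 (mod 12)`**
— the component `W8.E.[ℓ]` is NON-SPLIT exactly for `ℓ = 11, 23, 47, 59, 71, 83, …` (part B: `⇐`; two squares for
`ℓ ≡ 1 (mod 4)`, Thue with `d = 3` for `ℓ ≡ 1 (mod 3)`, `[2] = [3] = [1]`). [cite: Deligne1982HodgeCycles, §4 p. 30 (1) and Cor. 4.2]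
[cite: Landherr1936HermitianForms] -/
theorem zeta12_mk_prime_ne_splitDiscriminantClassCM_iff (ℓ : ℕ) (hℓ : ℓ.Prime) (u : (realField R)ˣ)
    (hu : (u : realField R) = ℓ) :
    (QuotientGroup.mk u : cmNormResidueGroup R) ≠ splitDiscriminantClassCM R 2 ↔ ℓ % 12 = 11 := by
  refine ⟨fun hne => ?_, fun h12 => zeta12_mk_prime_ne_splitDiscriminantClassCM_of_mod_twelve hR ℓ hℓ h12 u hu⟩
  haveI : Fact ℓ.Prime := ⟨hℓ⟩
  by_contra h12
  have h2 := hℓ.two_le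
  by_cases hle : ℓ ≤ 3
  · refine hne ((zeta12_table hR ℓ (by omega) (by omega) u hu).2 ?_)
    simp only [Finset.mem_insert, Finset.mem_singleton]; omega
  · have hd2 : ¬ 2 ∣ ℓ := fun h => by
      rcases (Nat.dvd_prime hℓ).1 h with h | h <;> omega
    have hd3 : ¬ 3 ∣ ℓ := fun h => by
      rcases (Nat.dvd_prime hℓ).1 h with h | h <;> omega
    have hcases : ℓ % 4 = 1 ∨ ℓ % 3 = 1 := by omega
    rcases hcases with h | h
    · obtain ⟨a, b, hab⟩ := Nat.Prime.sq_add_sq (p := ℓ) (by omega)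
      have habZ : ((a : ℤ)) ^ 2 + (b : ℤ) ^ 2 = ℓ := by exact_mod_cast hab
      exact hne (mk_eq_splitDiscriminantClassCM_two_of_coords_of_pos hR (by norm_num) (by norm_num)
        disc_not_sq_eight_four ℓ (4 * a) 0 (6 * b) b 4 (by norm_num) (by linear_combination 16 * habZ) (by ring) u
        (by rw [hu]; exact (map_natCast (AdjoinRoot.of (realPolyQ R)) ℓ).symm))
    · exact hne (zeta12_mk_prime_eq_splitDiscriminantClassCM_of_mod_three hR ℓ hℓ h u hu)

end Zeta12

end Summit.HodgeConjecture.HodgeConjecture.Ring2.WeilCoverageCM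

end
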